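import Literature.NumberTheory.Multiplicative.CorradiKatai1969.ThinFlip
import HarnessLib

/-!
# Corrádi–Kátai (1969), Conjecture 1: `C(f) = ∞`, not character-type, `h_f ≠ o(n)` — Theorem CE

Source: K. A. Corrádi and I. Kátai, *Some problems concerning the convolutions of number-theoretical functions*,
Arch. Math. (Basel) **20** (1969) 24–29, doi:10.1007/BF01898986 [CorradiKatai1969], p. 25: the class `M` of
multiplicative `±1`-valued functions, `h_f(n) = Σ_{ν=1}^{n−1} f(ν)f(n−ν)` ((1.1)), relation (1.2) `h_f(n) = o(n)`,
`C(f) = Σ_{p : f(p) = −1} 1/p`, "character-type" (periodic on the residues coprime to some `K ≥ 1`), and their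
**Conjecture 1** (p. 25, verbatim modulo notation): "If f ∈ M and f is not a 'character-type', then for the fulfilment
of (1.2) the condition C(f) = ∞ is a necessary and sufficient one."  CATEGORY: an explicitly labelled conjecture,
REFUTED (the sufficiency half fails) by an explicit family of counterexamples.  The analytic input is Dirichlet's
theorem in the form `Σ_{p ≡ a (k)} 1/p = ∞` for `(a,k) = 1` (H. L. Montgomery, R. C. Vaughan, *Multiplicative Number
Theory I*, CUP 2007 [MontgomeryVaughan2007], Cor. 4.12(c), p. 103), which is the tree theorem
`Literature.NumberTheory.LFunctions.not_summable_one_div_on_primes_in_residueClass` — so everything here is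
unconditional (standard axioms).

Counterexample (2001 H21 programme, Theorem 1.1 = `theoremCE`): for any infinite set `R` of odd primes with
`Σ_{p∈R} 1/p ≤ 1/8` (finitary form: every finite subsum `≤ 1/8`; one is constructed, `exists_admissible_R`: the least
primes above `16^{j+1}`), the completely multiplicative `f = fCE R` with `f(2) = 1`, `f(p) = χ₄(p)` (`p ∉ R`),
`f(p) = −χ₄(p)` (`p ∈ R`) has `C(f) = ∞`, is not of character-type, and `h_f(2^s) ≤ −2^{s−1} + 3` for all `s ≥ 2`
(unperturbed: `h_{f₀}(2^s) = −2^s + 3`, Lemma 2.1 `hCK_f0_two_pow`; thin-flip comparison `hCK_fCE_two_pow_le`), so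
`h_f(n) ≠ o(n)`: sufficiency fails, **`ckStatementOne_false : ¬ CKStatementOne`**.

This module (2001 file, third part; the two places where the analytic input is consumed): `cInfinite_fCE`
(`C(f) = ∞`: the primes `≡ 3 (mod 4)` outside `R` already give a divergent sum — interface at `k = 4`, `a = 3`),
`not_isCharacterType_fCE` (for any period `K`, a prime `q ≡ a (mod 4K)` outside `R` and one inside differ in sign —
interface at modulus `4K`), `not_isLittleO_hCK_fCE` (from `h_f(2^s) ≤ −2^{s−1} + 3`), and the assembled
`theoremCE (hdir : DirichletReciprocalDivergence) …` (all clauses of Theorem 1.1).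

Modules: `Literature.NumberTheory.Multiplicative.CorradiKatai1969.Defs` (objects, the interface Prop and its proof, the construction `f₀`, `Ω_R`, `fCE` and basic
facts), `.ThinFlip` (Lemma 2.1 and the thin-flip comparison: `h_f(2^s) ≤ −2^{s−1} + 3`), `.Density` (`C(f) = ∞`, not
character-type, `h_f ≠ o(n)`, `theoremCE`), `.Refutation` (an admissible `R` exists, `CKStatementOne`,
`ckStatementOne_false`, smoke tests).

Provenance: refutations bundle `papers/_cross/refutations` (H21 seat pub-refute-2, 2026-08-18), package modules
`Refutations.Vendor2001.CorradiKatai` (the 2001 H21 programme's kernel-checked file, archive route `summits/gb/free/y10`,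
refereed note Theorem 1.1, "upheld 2026-08-07"; namespace `CorradiKatai` there) and `Refutations.CorradiKatai1969`
(the unconditional wrapper), moved into the tree under the Lean-in-tree rule (human 2026-08-18).  Renamed:
`CKConjectureOne ↦ CKStatementOne`, `ckConjectureOne_false (hdir) ↦ ckStatementOne_false_of`, and the unconditional
`corradiKataiConjecture1_false ↦ ckStatementOne_false`; the 2001 interface Prop `DirichletReciprocalDivergence` is kept
and PROVED (`dirichletReciprocalDivergence`, module `Defs`).
-/

open Finset

namespace Literature.NumberTheory.Multiplicative.CorradiKatai1969

noncomputable section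
open scoped Classical

/-! ### `C(f) = ∞` (first clause; consumes the interface at `k = 4`, `a = 3`) -/

/-- Auxiliary lemma: `(hdir : DirichletReciprocalDivergence) {R : Set ℕ} (hR8 : ∀ F : Finset ℕ, (∀ p ∈ F, p ∈ R) → ∑ p ∈ F, (1 : ℝ) / p ≤ 1 / 8) : CInfinite (fCE R)`. [folklore] -/
theorem cInfinite_fCE (hdir : DirichletReciprocalDivergence) {R : Set ℕ}
    (hR8 : ∀ F : Finset ℕ, (∀ p ∈ F, p ∈ R) → ∑ p ∈ F, (1 : ℝ) / p ≤ 1 / 8) :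
    CInfinite (fCE R) := by
  intro hsum
  have hRsum : Summable (Set.indicator R fun n => (1 : ℝ) / n) :=
    summable_indicator_of_subsums_le hR8
  have hdom : ∀ n : ℕ,
      Set.indicator {p : ℕ | p.Prime ∧ p % 4 = 3 % 4} (fun m => (1 : ℝ) / m) n
      ≤ Set.indicator {p : ℕ | p.Prime ∧ fCE R p = -1} (fun m => (1 : ℝ) / m) n
        + Set.indicator R (fun m => (1 : ℝ) / m) n := by
    intro n
    by_cases hn : n ∈ {p : ℕ | p.Prime ∧ p % 4 = 3 % 4}
    · have hprime : n.Prime := hn.1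
      have hmod : n % 4 = 3 % 4 := hn.2
      have hmod3 : n % 4 = 3 := by omega
      have hodd : n % 2 = 1 := by omega
      rw [Set.indicator_of_mem hn]
      by_cases hnR : n ∈ R
      · have h2 : Set.indicator R (fun m => (1 : ℝ) / m) n = 1 / n :=
          Set.indicator_of_mem hnR _
        have h1 := indicator_one_div_nonneg {p : ℕ | p.Prime ∧ fCE R p = -1} n
        rw [h2]
        linarith
      · have hval : fCE R n = -1 := by
          rw [fCE_prime_of_notMem R hprime hodd hnR]
          exact ZMod.χ₄_nat_three_mod_four hmod3
        have hmem : n ∈ {p : ℕ | p.Prime ∧ fCE R p = -1} := ⟨hprime, hval⟩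
        have h1 : Set.indicator {p : ℕ | p.Prime ∧ fCE R p = -1} (fun m => (1 : ℝ) / m) n
            = 1 / n := Set.indicator_of_mem hmem _
        have h2 := indicator_one_div_nonneg R n
        rw [h1]
        linarith
    · rw [Set.indicator_of_notMem hn]
      have h1 := indicator_one_div_nonneg {p : ℕ | p.Prime ∧ fCE R p = -1} n
      have h2 := indicator_one_div_nonneg R n
      linarith
  have hsum34 : Summable
      (Set.indicator {p : ℕ | p.Prime ∧ p % 4 = 3 % 4} fun m => (1 : ℝ) / m) :=
    Summable.of_nonneg_of_le
      (fun n => indicator_one_div_nonneg _ n) hdom (hsum.add hRsum)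
  exact hdir 4 3 (by norm_num) (by decide) hsum34

/-! ### Not of character-type (second clause; consumes the interface at `k = 4K`) -/

/-- Auxiliary lemma: `(hdir : DirichletReciprocalDivergence) {R : Set ℕ} (hRinf : R.Infinite) (hRP : ∀ p ∈ R, Nat.Prime p ∧ p % 2 = 1) (hR8 : ∀ F : Finset ℕ, (∀ p ∈ F, p ∈ R) → ∑ p ∈ F, (1 : ℝ) / p ≤ 1 / 8) : ¬ IsCharacterType (fCE R)`. [folklore] -/
theorem not_isCharacterType_fCE (hdir : DirichletReciprocalDivergence) {R : Set ℕ}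
    (hRinf : R.Infinite) (hRP : ∀ p ∈ R, Nat.Prime p ∧ p % 2 = 1)
    (hR8 : ∀ F : Finset ℕ, (∀ p ∈ F, p ∈ R) → ∑ p ∈ F, (1 : ℝ) / p ≤ 1 / 8) :
    ¬ IsCharacterType (fCE R) := by
  rintro ⟨K, hK1, hct⟩
  -- a prime p ∈ R exceeding 4K (R is infinite)
  obtain ⟨p, hpR, hpK⟩ := hRinf.exists_gt (4 * K)
  obtain ⟨hpprime, hpodd⟩ := hRP p hpR
  have h4K1 : 1 < 4 * K := by omega
  haveI : NeZero (4 * K) := ⟨by omega⟩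
  have hcop : Nat.Coprime p (4 * K) := by
    rw [Nat.Prime.coprime_iff_not_dvd hpprime]
    intro hdvd
    have := Nat.le_of_dvd (by omega) hdvd
    omega
  -- the inverse residue a of p mod 4K
  set u : (ZMod (4 * K))ˣ := ZMod.unitOfCoprime p hcop with hu
  set a : ℕ := ((u⁻¹ : (ZMod (4 * K))ˣ) : ZMod (4 * K)).val with ha
  have hacop : Nat.Coprime a (4 * K) := ZMod.val_coe_unit_coprime u⁻¹
  have halt : a < 4 * K := ZMod.val_lt _
  have haz : ((a : ℕ) : ZMod (4 * K)) = ((u⁻¹ : (ZMod (4 * K))ˣ) : ZMod (4 * K)) := by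
    rw [ha, ZMod.natCast_val, ZMod.cast_id]
  have hap : (a * p) % (4 * K) = 1 % (4 * K) := by
    have h1 : ((a * p : ℕ) : ZMod (4 * K)) = ((1 : ℕ) : ZMod (4 * K)) := by
      push_cast
      rw [haz, ← ZMod.coe_unitOfCoprime p hcop, ← hu, ← Units.val_mul, inv_mul_cancel,
        Units.val_one]
    exact (ZMod.natCast_eq_natCast_iff' _ _ _).mp h1
  have h1mod : 1 % (4 * K) = 1 := Nat.mod_eq_of_lt h4K1
  -- a is odd
  have haodd : a % 2 = 1 := by
    have hd : (2 : ℕ) ∣ 4 * K := ⟨2 * K, by ring⟩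
    have hmm := Nat.mod_mod_of_dvd (a * p) hd
    have hap2 : (a * p) % 2 = 1 := by omega
    rcases Nat.even_or_odd a with he | ho
    · exfalso
      obtain ⟨t, ht⟩ := he
      have : a * p = 2 * (t * p) := by rw [ht]; ring
      omega
    · exact Nat.odd_iff.mp ho
  -- a prime q ≡ a (mod 4K) outside R (interface + summability of R)
  have hq : ∃ q : ℕ, q.Prime ∧ q % (4 * K) = a % (4 * K) ∧ q ∉ R := by
    by_contra hno
    have hno' : ∀ q : ℕ, q.Prime → q % (4 * K) = a % (4 * K) → q ∈ R := by
      intro q hq hmod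
      by_contra hqR
      exact hno ⟨q, hq, hmod, hqR⟩
    apply hdir (4 * K) a (by omega) hacop
    refine Summable.of_nonneg_of_le (fun n => indicator_one_div_nonneg _ n) (fun n => ?_)
      (summable_indicator_of_subsums_le hR8)
    by_cases hn : n ∈ {p : ℕ | p.Prime ∧ p % (4 * K) = a % (4 * K)}
    · rw [Set.indicator_of_mem hn]
      have hnR : n ∈ R := hno' n hn.1 hn.2
      rw [Set.indicator_of_mem hnR]
    · rw [Set.indicator_of_notMem hn]
      exact indicator_one_div_nonneg R n
  obtain ⟨q, hqprime, hqmod, hqR⟩ := hq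
  -- q is odd
  have hamod : a % (4 * K) = a := Nat.mod_eq_of_lt halt
  have hqodd : q % 2 = 1 := by
    have hd : (2 : ℕ) ∣ 4 * K := ⟨2 * K, by ring⟩
    have h1 := Nat.mod_mod_of_dvd q hd
    have h2 := Nat.mod_mod_of_dvd a hd
    omega
  -- pq ≡ 1 (mod 4K), hence mod K and mod 4
  have hpqz : ((p * q : ℕ) : ZMod (4 * K)) = ((1 : ℕ) : ZMod (4 * K)) := by
    have hqz : ((q : ℕ) : ZMod (4 * K)) = ((a : ℕ) : ZMod (4 * K)) :=
      (ZMod.natCast_eq_natCast_iff' _ _ _).mpr hqmod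
    have hapz : ((a * p : ℕ) : ZMod (4 * K)) = ((1 : ℕ) : ZMod (4 * K)) :=
      (ZMod.natCast_eq_natCast_iff' _ _ _).mpr hap
    push_cast at hqz hapz ⊢
    rw [hqz]
    calc ((p : ℕ) : ZMod (4 * K)) * ((a : ℕ) : ZMod (4 * K))
        = ((a : ℕ) : ZMod (4 * K)) * ((p : ℕ) : ZMod (4 * K)) := by ring
      _ = 1 := hapz
  have hpqmod : (p * q) % (4 * K) = 1 % (4 * K) :=
    (ZMod.natCast_eq_natCast_iff' _ _ _).mp hpqz
  have hK4 : (K : ℕ) ∣ 4 * K := ⟨4, by ring⟩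
  have h44 : (4 : ℕ) ∣ 4 * K := ⟨K, rfl⟩
  have hmK : (p * q) % K = 1 % K := by
    have h1 := Nat.mod_mod_of_dvd (p * q) hK4
    have h2 := Nat.mod_mod_of_dvd 1 hK4
    rw [← h1, ← h2, hpqmod]
  have hm4 : (p * q) % 4 = 1 := by
    have h1 := Nat.mod_mod_of_dvd (p * q) h44
    have h2 := Nat.mod_mod_of_dvd 1 h44
    rw [← h1, hpqmod, h2]
  -- f(pq) = −χ₄(pq) = −1
  have hfq : fCE R q = ZMod.χ₄ ((q : ℕ) : ZMod 4) := fCE_prime_of_notMem R hqprime hqodd hqR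
  have hfp : fCE R p = - ZMod.χ₄ ((p : ℕ) : ZMod 4) := fCE_prime_of_mem R hpprime hpodd hpR
  have hchi : ZMod.χ₄ (((p * q : ℕ) : ℕ) : ZMod 4) = 1 := ZMod.χ₄_nat_one_mod_four hm4
  have hfm : fCE R (p * q) = -1 := by
    rw [fCE_mul R hpprime.one_lt.le hqprime.one_lt.le, hfp, hfq]
    rw [show (((p * q : ℕ) : ℕ) : ZMod 4) = ((p : ℕ) : ZMod 4) * ((q : ℕ) : ZMod 4) by
      push_cast; ring] at hchi
    rw [map_mul] at hchi
    calc (- ZMod.χ₄ ((p : ℕ) : ZMod 4)) * ZMod.χ₄ ((q : ℕ) : ZMod 4)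
        = -(ZMod.χ₄ ((p : ℕ) : ZMod 4) * ZMod.χ₄ ((q : ℕ) : ZMod 4)) := by ring
      _ = -1 := by rw [hchi]
  -- contradiction with character-type at (pq, 1)
  have hcontra := hct (p * q) 1
    (Nat.one_le_iff_ne_zero.mpr (Nat.mul_ne_zero hpprime.pos.ne' hqprime.pos.ne'))
    le_rfl hmK (Nat.coprime_one_left K)
  rw [hfm, fCE_one] at hcontra
  norm_num at hcontra

/-! ### `h_f(n) = o(n)` fails (the "in particular" of Theorem 1.1) -/

/-- Auxiliary lemma: `{R : Set ℕ} (hR8 : ∀ F : Finset ℕ, (∀ p ∈ F, p ∈ R) → ∑ p ∈ F, (1 : ℝ) / p ≤ 1 / 8) : ¬ IsLittleO (hCK (fCE R))`. [folklore] -/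
theorem not_isLittleO_hCK_fCE {R : Set ℕ}
    (hR8 : ∀ F : Finset ℕ, (∀ p ∈ F, p ∈ R) → ∑ p ∈ F, (1 : ℝ) / p ≤ 1 / 8) :
    ¬ IsLittleO (hCK (fCE R)) := by
  intro h
  obtain ⟨N₀, hN₀⟩ := h (1 / 4) (by norm_num)
  set s : ℕ := max 4 N₀ with hsdef
  have hs4 : 4 ≤ s := le_max_left _ _
  have hsN : N₀ ≤ 2 ^ s := by
    have h1 : N₀ ≤ s := le_max_right _ _
    have h2 : s < 2 ^ s := s.lt_two_pow_self
    omega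
  have hbound := hN₀ (2 ^ s) hsN
  have hval : hCK (fCE R) (2 ^ s) ≤ -(2 ^ (s - 1) : ℤ) + 3 :=
    hCK_fCE_two_pow_le hR8 (by omega)
  -- powers bookkeeping in ℝ
  have hpow1 : (2 : ℝ) ^ s = 2 ^ (s - 1) * 2 := by
    rw [← pow_succ]
    congr 1
    omega
  have hpow2 : (2 : ℝ) ^ (s - 1) = 2 ^ (s - 2) * 2 := by
    rw [← pow_succ]
    congr 1
    omega
  have hposN : (4 : ℕ) ≤ 2 ^ (s - 2) := by
    calc (4 : ℕ) = 2 ^ 2 := by norm_num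
    _ ≤ 2 ^ (s - 2) := Nat.pow_le_pow_right (by norm_num) (by omega)
  have hpos : (4 : ℝ) ≤ 2 ^ (s - 2) := by exact_mod_cast hposN
  have hcast : ((hCK (fCE R) (2 ^ s) : ℤ) : ℝ) ≤ -(2 : ℝ) ^ (s - 1) + 3 := by
    exact_mod_cast hval
  rw [abs_le] at hbound
  have hlow := hbound.1
  push_cast at hlow
  linarith

/-! ### Theorem 1.1 (thm:CE), assembled -/

/-- **Theorem 1.1 of the paper (thm:CE)**.  Let `R` be an infinite set of odd primes
with all finite subsums of `∑_{p∈R} 1/p` bounded by `1/8`, and let `f = fCE R` (the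
completely multiplicative `±1`-function with `f(2) = 1`, `f(p) = χ₄(p)` for odd
`p ∉ R`, `f(p) = −χ₄(p)` for `p ∈ R`; uniqueness: `eq_fCE_of_prime_values`).  Then,
granting the named analytic interface `DirichletReciprocalDivergence`:
`C(f) = ∞`, `f` is not of character-type, `h_f(2^s) ≤ −2^{s−1} + 3` for all `s ≥ 2`,
and in particular `h_f(n) = o(n)` fails. [folklore] -/
theorem theoremCE (hdir : DirichletReciprocalDivergence) (R : Set ℕ) (hRinf : R.Infinite)
    (hRP : ∀ p ∈ R, Nat.Prime p ∧ p % 2 = 1)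
    (hR8 : ∀ F : Finset ℕ, (∀ p ∈ F, p ∈ R) → ∑ p ∈ F, (1 : ℝ) / p ≤ 1 / 8) :
    IsCompletelyMultPM (fCE R) ∧
    fCE R 2 = 1 ∧
    (∀ p : ℕ, p.Prime → p % 2 = 1 → p ∉ R → fCE R p = ZMod.χ₄ ((p : ℕ) : ZMod 4)) ∧
    (∀ p ∈ R, fCE R p = - ZMod.χ₄ ((p : ℕ) : ZMod 4)) ∧
    CInfinite (fCE R) ∧
    ¬ IsCharacterType (fCE R) ∧
    (∀ s : ℕ, 2 ≤ s → hCK (fCE R) (2 ^ s) ≤ -(2 ^ (s - 1) : ℤ) + 3) ∧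
    ¬ IsLittleO (hCK (fCE R)) := by
  have h2R : 2 ∉ R := fun h2 => by
    have := (hRP 2 h2).2
    omega
  refine ⟨isCompletelyMultPM_fCE R, fCE_two R h2R,
    fun p hp hodd hpR => fCE_prime_of_notMem R hp hodd hpR,
    fun p hpR => fCE_prime_of_mem R (hRP p hpR).1 (hRP p hpR).2 hpR,
    cInfinite_fCE hdir hR8,
    not_isCharacterType_fCE hdir hRinf hRP hR8,
    fun s hs => hCK_fCE_two_pow_le hR8 hs,
    not_isLittleO_hCK_fCE hR8⟩

end

end Literature.NumberTheory.Multiplicative.CorradiKatai1969
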